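import Summits.BirchSwinnertonDyer.BirchSwinnertonDyer.Theses.SignedLowerHalves
import Summits.BirchSwinnertonDyer.BirchSwinnertonDyer.Theorems.SignedLowerHalvesKobayashiMainConjectureSmallImageSignedMuOneSign
import Summits.BirchSwinnertonDyer.BirchSwinnertonDyer.Theorems.SignedLowerHalvesKobayashiMainConjectureSmallImageAcnsDescent
import Literature.NumberTheory.EllipticCurves.Kobayashi2003.SignedPAdicLFunctionUniqueProofs
import Summits.BirchSwinnertonDyer.Rank1Residual.X11a.MuLambdaSplit
import HarnessLib

/-!
# Route `SignedLowerHalves`, crux `KobayashiMainConjectureSmallImage` (item stmt-BirchSwinnertonDyer-19002):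
# the crux BY NAME from the «acns» package stub T3, the ONE-SIGN analytic `μ`-rider and the held inputs —
# BOTH stubs of line `birth` discharged modulo those (cell `bsd-ssimc`, seat `bsd-line-slh-p3` gen 5, line
# `birth`; THEOREMS ONLY; the route-importing composition kept in its own small file, as k3-c4x part 5;
# helper file `--supports` item 4)

PARTITION (cell bsd-ssimc): X7 (A7) × item 4's whole domain. CONDITIONAL composition; closes none; crux 4
OPEN. BSD is not proved by any of this.

## The convergence

Line `birth` (skeleton b1bf5b11) = `stub_lowerSmallImage` (Eisenstein half, ∃ sign; «no engine in print») +
`stub_saturationSmallImage` (lower ⇒ equality, every sign). Two independent reductions now meet: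

* lane B of seat k3-c4x (parts 1–5, `…SmallImageSignedMu{Transfer,OneSign,Crux}.lean`, p533653/p536189):
  `stub_saturationSmallImage` ⟸ published facts (Kobayashi Thm 1.2 / 4.1-rational, the period-unit pair
  `h5`/`h3`) + ONE reviewed construction fact (`thm62_63_73_signedColemanKato_zeta`) + the ONE-SIGN analytic
  rider `hμan₀`: «for the newform `f` of `E`, SOME `L_p^{ε₀}(E)` has unit content» (= `min(μ⁺, μ⁻) = 0`);
* this seat (gen 5, `…SmallImageAcnsDescent.lean` p620906 with p619183 / p619556 / p620177): at `5 ≤ p`,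
  `KobayashiLowerDivisibility W p ε` ⟸ the K1″-shaped package of the designed line «acns» (stub T3
  `CanonicalNs`, OPEN) + the PRE/PUB binders of `SignedBaseChange`'s K2R⁗ + `μ(L_p^ε(E)) = 0` AT THAT SIGN —
  with NO image hypothesis and NO `μ` of any auxiliary twist.

Feeding the SAME sign `ε₀` of `hμan₀` to both: **crux 4 ⟸ T3 ∧ `hμan₀` ∧ {h41, h12, h5, h3, hCK, hmodP,
h422 (PUB); hGF, hpkg (PRE)} ∧ the Eisenstein half at `p = 3`** (`kobayashiMainConjectureSmallImage_of_acns`; the pattern of k3-c4x part 5 `…SignedMuCrux`, p536189).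
Both registered stubs of `birth` are thereby PROVED modulo {T3, `hμan₀`, held inputs, `p = 3`}: this is the
reshape this seat offers the pen (candidate skeleton `birth_acns`, evidence on the item; NOT registered here).

* `mu_kobayashiL_eq_zero_of_signed_hasUnitContent` — dictionary: the rider in k3-c4x's currency
  (`∃ L₀, IsSignedPAdicLFunction f p ε L₀ ∧ HasUnitContent L₀`) gives `μ(kobayashiL ε L⁺ L⁻) = 0` for every
  Pollack pair (uniqueness of Pollack's `L_p^ε`, `IsSignedPAdicLFunction.unique`; `X11a.mu_eq_zero_of_hasUnitContent`).
* `kobayashiLowerDivisibility_of_package_of_signed_hasUnitContent_noSurj` — part 2's descent with the rider in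
  that currency.
* `kobayashiMainConjectureSmallImage_of_acns` — the composition BY NAME.

HONEST SCOPE: every hypothesis is displayed; T3 and `hμan₀` are OPEN (T3's engines L1/L2 not in print at
normaliser-of-Cartan image; `hμan₀` = half of the Perrin-Riou–Pollack conjecture, per pair a finite
computation); the PRE binders are preprint content; nothing is asserted about any of them; nothing booked.

References: [Kobayashi2003] Conjecture (p. 2), Thm 1.2, 4.1, 6.2–6.3, 7.3; [Kato2004Asterisque] Thm 12.6, §13.8;
[BurungaleSkinnerTianWan2024] §2.3, Props 1.18/2.7/5.19, Thm 6.17; [BurungaleCastellaSkinner2025] Prop 4.2.2;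
[MatarNekovar2019] Prop 5.26; [Pollack2003] Conj 6.3, Prop 6.18; [GreenbergVatsal2000] (2), §3 Rem 3.4.
-/

set_option autoImplicit false
-- justification: the layout's summit-side namespace for a single-conjunct summit (Sub = Summit) repeats the
-- component `BirchSwinnertonDyer`; helper files live under `Summit.<S>.<Sub>.Theorems`.
set_option linter.dupNamespace false

noncomputable section

open scoped Classical MatrixGroups ModularForm

open CongruenceSubgroup WeierstrassCurve Field
  Literature.NumberTheory.EllipticCurves Literature.NumberTheory.EllipticCurves.ModularForms
  Literature.NumberTheory.EllipticCurves.Rank1Residual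
  Literature.NumberTheory.EllipticCurves.Kobayashi2003
  Literature.NumberTheory.EllipticCurves.GreenbergVatsal2000
  Literature.NumberTheory.EllipticCurves.BurungaleSkinnerTianWan2024
  Literature.NumberTheory.EllipticCurves.BurungaleCastellaSkinner2025
  Summit.BirchSwinnertonDyer.Rank1Residual Summit.BirchSwinnertonDyer.Rank1Residual.Supersingular
  Summit.BirchSwinnertonDyer.BirchSwinnertonDyer.Theorems.SmallImageAcnsDescent

namespace Summit.BirchSwinnertonDyer.BirchSwinnertonDyer.Theorems.SmallImageAcnsCrux

/-- **Dictionary for the one-sign rider.** If SOME `L₀ ∈ Λ` satisfying Pollack's parity-`ε` congruences for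
the newform `f` has unit content, then Kobayashi's `L_p^ε = kobayashiL ε L⁺ L⁻` of EVERY Pollack pair of `f`
has `μ = 0` (such an `L` is unique: `IsSignedPAdicLFunction.unique`; `μ = 0 ⟸` unit content).
[cite: Pollack2003, Prop. 6.18 and Prop. 6.9 (uniqueness)] [cite: GreenbergVatsal2000, p. 2, (2)] -/
theorem mu_kobayashiL_eq_zero_of_signed_hasUnitContent {p : ℕ} [Fact p.Prime] {N : ℕ}
    {f : CuspForm (Gamma0 N) 2} {ε : ℤˣ} {L₀ : IwasawaAlgebra p}
    (hL₀ : IsSignedPAdicLFunction f p ε L₀) (hu : HasUnitContent L₀)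
    {Lplus Lminus : IwasawaAlgebra p} (hPP : IsPollackPair f p Lplus Lminus) :
    X1.MuLambda.mu (kobayashiL ε Lplus Lminus) = 0 := by
  have h : kobayashiL ε Lplus Lminus = L₀ := (hPP.isSignedPAdicLFunction_kobayashiL ε).unique hL₀
  rw [h]
  exact X11a.mu_eq_zero_of_hasUnitContent hu

/-- **The integral Eisenstein half from the K1″ package and the one-sign rider in the unit-content currency
— NO image hypothesis.** Part 2's `kobayashiLowerDivisibility_of_package_of_mu_noSurj` with its `μ`-input
spelled as in k3-c4x's `hμan₀` at the sign `ε`: for the conductor-level newform `f` of `W`, SOME `L₀` with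
`IsSignedPAdicLFunction f p ε L₀ ∧ HasUnitContent L₀`. [cite: Kobayashi2003, Conjecture (Main Conjecture) (p. 2), Thm. 1.2, Thm. 4.1 (p. 8)]
[cite: GreenbergVatsal2000, p. 4 and §3 Remark 3.4] [cite: Pollack2003, Conj. 6.3 (p. 548), Prop. 6.18] -/
theorem kobayashiLowerDivisibility_of_package_of_signed_hasUnitContent_noSurj
    (h422 : prop422_greenbergAnyRoot_hasUnitContent_minus)
    (hpkg : props118_27_519_exists_signedTwoVariablePackage_supersingular_PRE) :
    Literature.NumberTheory.EllipticCurves.Kobayashi2003.thm41_signedCharIdeal_divisibility → Literature.NumberTheory.EllipticCurves.Kobayashi2003.thm12_signedSelmerDual_finite_torsion → Literature.NumberTheory.EllipticCurves.ModularForms.nonempty_modularParametrizationData → Literature.NumberTheory.EllipticCurves.realPeriodRat_eq_unit_mul_plusPeriod → Literature.NumberTheory.EllipticCurves.BurungaleSkinnerTianWan2024.thm617_exists_commonKatzFrame_isGreenbergLFunctionAnyRoot₂_supersingular_PRE → ∀ (W : WeierstrassCurve ℚ) [W.IsElliptic] [W.IsGloballyMinimal] (p : ℕ) [Fact p.Prime],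 5 ≤ p → Literature.NumberTheory.EllipticCurves.Rank1Residual.ClassX7 W p → (∃ (K : Type) (_ : Field K) (_ : NumberField K) (ι : PadicAlgCl p ≃+* ℂ) (v vbar : IsDedekindDomain.HeightOneSpectrum (NumberField.RingOfIntegers K)) (κ₁ κ₂ : Literature.NumberTheory.EllipticCurves.ZpExtension K p) (γ₁ γ₂ : Field.absoluteGaloisGroup K) (_ : Fact (Literature.NumberTheory.EllipticCurves.ZpExtension.IsTopGeneratorPair κ₁ κ₂ γ₁ γ₂)) (_ : NeZero (NumberField.discr K).natAbs) (N : ℕ) (_ : NeZero N) (f : CuspForm (CongruenceSubgroup.Gamma0 N) 2) (d : ℤ) (W' : WeierstrassCurve ℚ) (_ : W'.IsElliptic) (_ : W'.IsGloballyMinimal) (C : WeierstrassCurve.VariableChange ℚ) (N' : ℕ) (_ : NeZero N') (f' : CuspForm (CongruenceSubgroup.Gamma0 N') 2), Literature.NumberTheory.EllipticCurves.ModularForms.IsNewformOf W f ∧ (N : ℤ) = W.conductorNorm ℤ ∧ Literature.NumberTheory.EllipticCurves.ModularForms.IsNewformOf W' f' ∧ (N' : ℤ) = W'.conductorNorm ℤ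 ∧ Squarefree d ∧ 1 < d ∧ (∀ q : ℕ, q.Prime → Literature.NumberTheory.EllipticCurves.BurungaleSkinnerTianWan2024.RamifiedInQuadratic d q → q ≠ p ∧ ¬ q ∣ N ∧ ¬ (q : ℤ) ∣ NumberField.discr K) ∧ C • W' = W.quadraticTwist (d : ℚ) ∧ Literature.NumberTheory.EllipticCurves.IsImaginaryQuadratic K ∧ ((Ideal.span {(p : ℤ)}).primesOver (NumberField.RingOfIntegers K)).ncard = 2 ∧ ((p : ℕ) : NumberField.RingOfIntegers K) ∈ v.asIdeal ∧ ((p : ℕ) : NumberField.RingOfIntegers K) ∈ vbar.asIdeal ∧ vbar ≠ v ∧ (∀ (w : NumberField.InfinitePlace K) (k : NumberField.RingOfIntegers K), k ∈ v.asIdeal ↔ ‖ι.symm (w.embedding (k : K))‖ < 1) ∧ IsCoprime (N : ℤ) (NumberField.discr K) ∧ (∀ ℓ : ℕ, ℓ.Prime → ℓ ∣ N → ((Ideal.span {(ℓ : ℤ)}).primesOver (NumberField.RingOfIntegers K)).ncard = 2) ∧ (∀ ℓ : ℕ, ℓ.Prime → (ℓ : ℤ) ∣ d → ((Ideal.span {(ℓ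 : ℤ)}).primesOver (NumberField.RingOfIntegers K)).ncard = 2) ∧ ((Ideal.span {(2 : ℤ)}).primesOver (NumberField.RingOfIntegers K)).ncard = 2 ∧ (∀ ρ : Literature.NumberTheory.GaloisRepresentations.ModPGaloisRep K (ZMod p) 2, (W.baseChange K).IsTorsionGaloisRep p ρ → Literature.NumberTheory.GaloisRepresentations.FramedRep.IsAbsolutelyIrreducible ρ) ∧ κ₁.IsCyclotomic ∧ κ₂.IsAnticyclotomic ∧ (∃ ζ : ℤ_[p]ˣ, IsOfFinOrder ζ ∧ ((Literature.NumberTheory.GaloisRepresentations.GaloisRep.cyclotomicCharacter K p γ₁ * ζ : ℤ_[p]ˣ) : ℤ_[p]) = (Literature.NumberTheory.EllipticCurves.cyclotomicGenerator p : ℤ_[p])) ∧ ∀ (Ω δ : ℂ) (Ωp : (Literature.NumberTheory.EllipticCurves.unrIntegers p)ˣ) (LK G G' : PowerSeries (PowerSeries (PadicComplexInt p))), Ω ≠ 0 → (δ ^ 2 = (NumberField.discr K : ℂ) ∨ δ ^ 2 = -(NumberField.discr K : ℂ)) → Literature.NumberTheory.EllipticCurves.IsKatzMeasure₂ ι v vbar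 ∅ κ₁ κ₂ γ₁⁻¹ γ₂⁻¹ 1 Ω δ ((Ωp : Literature.NumberTheory.EllipticCurves.unrIntegers p) : PadicComplex p) LK → Literature.NumberTheory.EllipticCurves.IsGreenbergLFunctionAnyRoot₂ ι v vbar κ₁ κ₂ γ₁⁻¹ γ₂⁻¹ f (NumberField.discr K).natAbs (NumberField.classNumber K) LK G → Literature.NumberTheory.EllipticCurves.IsGreenbergLFunctionAnyRoot₂ ι v vbar κ₁ κ₂ γ₁⁻¹ γ₂⁻¹ f' (NumberField.discr K).natAbs (NumberField.classNumber K) LK G' → ∀ J : ℤ_[p] →+* PadicComplexInt p, (∀ x : ℤ_[p], ((J x : PadicComplexInt p) : PadicComplex p) = ((x : ℚ_[p]) : PadicComplex p)) → ∃ s : PowerSeries (PadicComplexInt p), s ≠ 0 ∧ Ideal.span {PowerSeries.map (PowerSeries.C (R := PadicComplexInt p)) s} * ((WeierstrassCurve.XGr₂.charIdeal (W.baseChange K) p κ₁ κ₂ vbar γ₁ γ₂).map (Literature.NumberTheory.EllipticCurves.IwasawaAlgebra₂.toUnr₂ p J) * (WeierstrassCurve.XGr₂.charIdeal (W'.baseChange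 K) p κ₁ κ₂ vbar γ₁ γ₂).map (Literature.NumberTheory.EllipticCurves.IwasawaAlgebra₂.toUnr₂ p J)) ≤ Ideal.span {G * G'}) →
    ∀ ε : ℤˣ,
      (∀ [NeZero (W.conductorNorm ℤ)] (f : CuspForm (Gamma0 (W.conductorNorm ℤ)) 2), IsNewformOf W f →
        ∃ L₀ : IwasawaAlgebra p, IsSignedPAdicLFunction f p ε L₀ ∧ HasUnitContent L₀) →
      Summit.BirchSwinnertonDyer.Rank1Residual.Supersingular.KobayashiLowerDivisibility W p ε := by
  intro h41 h12 hmodP h5 hGF W _ _ p _ hp5 hX hP ε hμ κ γ hκ hγ hγ' _ f hf ϖ hϖ Lp Lm hPP D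
  have hp2 : p ≠ 2 := by omega
  obtain ⟨g, t, hchar, hdvd⟩ :=
    rationalLowerDivisibility_of_package_noSurj h422 hpkg h41 h12 hmodP hGF W p hp5 hX hP ε κ γ hκ hγ hγ' f hf
      Lp Lm hPP D
  -- integral, since `μ(L_p^ε) = 0` (one-sign rider, unit-content currency)
  obtain ⟨L₀, hL₀, hu⟩ := hμ f hf
  obtain ⟨k, hk⟩ : kobayashiL ε Lp Lm ∣ g :=
    MuSplit.dvd_of_dvd_C_pow_mul_of_mu_eq_zero' (mu_kobayashiL_eq_zero_of_signed_hasUnitContent hL₀ hu hPP) hdvd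
  -- Néron normalisation: `ϖ` is a `p`-adic unit
  have hϖ0 : ϖ ≠ 0 := hf.periodRatio_ne_zero hϖ
  have hvϖ : padicValRat p ϖ = 0 :=
    padicValRat_periodRatio_eq_zero_of_five_le h5 W p hp5 hX.1.1 (ClassX7.irr W p hp2 hX) f hf ϖ hϖ
  obtain ⟨u, hu'⟩ := exists_units_coe_eq_ratCast hϖ0 hvϖ
  refine ⟨g, PowerSeries.C ((u⁻¹ : ℤ_[p]ˣ) : ℤ_[p]) * k, hchar, ?_⟩
  refine (MuSplit.iota_eq_C_mul_iota_iff u hu' g _).mpr ?_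
  calc g = kobayashiL ε Lp Lm * k := hk
    _ = (PowerSeries.C (u : ℤ_[p]) * PowerSeries.C ((u⁻¹ : ℤ_[p]ˣ) : ℤ_[p])) * (kobayashiL ε Lp Lm * k) := by
        rw [← map_mul, Units.mul_inv, map_one, one_mul]
    _ = PowerSeries.C (u : ℤ_[p]) * (kobayashiL ε Lp Lm * (PowerSeries.C ((u⁻¹ : ℤ_[p]ˣ) : ℤ_[p]) * k)) := by
        ring

/-- **Crux 4 BY NAME from «acns» T3, the one-sign rider, the held inputs, and the Eisenstein half at `p = 3`.**
Granted: the reviewed construction fact `hCK` and the PUBLISHED named facts `h12`, `h41`, `h5`, `h3`, `hmodP`,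
`h422`; the PREPRINT binders `hpkg` (BSTW signed two-variable package) and `hGF` (BSTW Thm 6.17 common frame);
**T3** `hT3` — the K1″-shaped canonical twist-pair Greenberg product package on the crux's domain at `5 ≤ p`
(VERBATIM the `∃`-body of `SignedBaseChange.TwistPairGreenbergProductDivisibilityCanonical`; = the ideator's
`Acns.CanonicalNs` with `SignedTwoVariableInputs` spelled as its conjunction; OPEN); the ONE-SIGN analytic rider
**`hμan₀`** (k3-c4x currency; OPEN class-wide, per pair computable); and **`hthree`** — the Eisenstein half
`∃ ε, KobayashiLowerDivisibility W 3 ε` on the `p = 3` rows (the PRE binders carry `5 ≤ p`). Then the route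
decl `Theses.SignedLowerHalves.KobayashiMainConjectureSmallImage` holds: at `5 ≤ p` the sign `ε₀` of `hμan₀`
feeds BOTH this seat's descent (`KobayashiLowerDivisibility W p ε₀`) and k3-c4x's saturation; at `p = 3`,
`hthree` + saturation. CONDITIONAL; nothing asserted beyond the binders; closes nothing.
[cite: Kobayashi2003, Conjecture (p. 2), Thm. 4.1 (p. 8), Thm. 6.3 (p. 11), Thm. 7.3 (p. 13)]
[cite: Kato2004Asterisque, Thm. 12.6 (p. 222), §13.8 (pp. 228–229)]
[cite: BurungaleSkinnerTianWan2024, §2.3 proof of Thm. (KoMC_r) (arXiv v2 TeX store p0076 L36–L65) (assembly; OPEN binders)] -/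
theorem kobayashiMainConjectureSmallImage_of_acns
    (hCK : thm62_63_73_signedColemanKato_zeta)
    (h12 : Kobayashi2003.thm12_signedSelmerDual_finite_torsion)
    (h41 : Kobayashi2003.thm41_signedCharIdeal_divisibility)
    (h5 : realPeriodRat_eq_unit_mul_plusPeriod) (h3 : realPeriodRat_eq_unit_mul_plusPeriod_three)
    (hmodP : Literature.NumberTheory.EllipticCurves.ModularForms.nonempty_modularParametrizationData)
    (h422 : prop422_greenbergAnyRoot_hasUnitContent_minus)
    (hpkg : props118_27_519_exists_signedTwoVariablePackage_supersingular_PRE)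
    (hGF : thm617_exists_commonKatzFrame_isGreenbergLFunctionAnyRoot₂_supersingular_PRE)
    (hT3 : (prop422_greenbergAnyRoot_hasUnitContent_minus ∧ props118_27_519_exists_signedTwoVariablePackage_supersingular_PRE) → Literature.NumberTheory.EllipticCurves.ModularForms.nonempty_modularParametrizationData → ∀ (W : WeierstrassCurve ℚ) [W.IsElliptic] [W.IsGloballyMinimal] (p : ℕ) [Fact p.Prime], 5 ≤ p → Literature.NumberTheory.EllipticCurves.Rank1Residual.ClassX7 W p → ¬ W.HasCM → W.frobeniusTrace p = 0 → ¬ Literature.NumberTheory.EllipticCurves.Rank1Residual.Surj W p → (∃ (K : Type) (_ : Field K) (_ : NumberField K) (ι : PadicAlgCl p ≃+* ℂ) (v vbar : IsDedekindDomain.HeightOneSpectrum (NumberField.RingOfIntegers K)) (κ₁ κ₂ : Literature.NumberTheory.EllipticCurves.ZpExtension K p) (γ₁ γ₂ : Field.absoluteGaloisGroup K) (_ : Fact (Literature.NumberTheory.EllipticCurves.ZpExtension.IsTopGeneratorPair κ₁ κ₂ γ₁ γ₂)) (_ : NeZero (NumberField.discr K).natAbs) (N : ℕ) (_ : NeZero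 N) (f : CuspForm (CongruenceSubgroup.Gamma0 N) 2) (d : ℤ) (W' : WeierstrassCurve ℚ) (_ : W'.IsElliptic) (_ : W'.IsGloballyMinimal) (C : WeierstrassCurve.VariableChange ℚ) (N' : ℕ) (_ : NeZero N') (f' : CuspForm (CongruenceSubgroup.Gamma0 N') 2), Literature.NumberTheory.EllipticCurves.ModularForms.IsNewformOf W f ∧ (N : ℤ) = W.conductorNorm ℤ ∧ Literature.NumberTheory.EllipticCurves.ModularForms.IsNewformOf W' f' ∧ (N' : ℤ) = W'.conductorNorm ℤ ∧ Squarefree d ∧ 1 < d ∧ (∀ q : ℕ, q.Prime → Literature.NumberTheory.EllipticCurves.BurungaleSkinnerTianWan2024.RamifiedInQuadratic d q → q ≠ p ∧ ¬ q ∣ N ∧ ¬ (q : ℤ) ∣ NumberField.discr K) ∧ C • W' = W.quadraticTwist (d : ℚ) ∧ Literature.NumberTheory.EllipticCurves.IsImaginaryQuadratic K ∧ ((Ideal.span {(p : ℤ)}).primesOver (NumberField.RingOfIntegers K)).ncard = 2 ∧ ((p : ℕ) : NumberField.RingOfIntegers K) ∈ v.asIdeal ∧ ((p : ℕ) : NumberField.RingOfIntegers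 K) ∈ vbar.asIdeal ∧ vbar ≠ v ∧ (∀ (w : NumberField.InfinitePlace K) (k : NumberField.RingOfIntegers K), k ∈ v.asIdeal ↔ ‖ι.symm (w.embedding (k : K))‖ < 1) ∧ IsCoprime (N : ℤ) (NumberField.discr K) ∧ (∀ ℓ : ℕ, ℓ.Prime → ℓ ∣ N → ((Ideal.span {(ℓ : ℤ)}).primesOver (NumberField.RingOfIntegers K)).ncard = 2) ∧ (∀ ℓ : ℕ, ℓ.Prime → (ℓ : ℤ) ∣ d → ((Ideal.span {(ℓ : ℤ)}).primesOver (NumberField.RingOfIntegers K)).ncard = 2) ∧ ((Ideal.span {(2 : ℤ)}).primesOver (NumberField.RingOfIntegers K)).ncard = 2 ∧ (∀ ρ : Literature.NumberTheory.GaloisRepresentations.ModPGaloisRep K (ZMod p) 2, (W.baseChange K).IsTorsionGaloisRep p ρ → Literature.NumberTheory.GaloisRepresentations.FramedRep.IsAbsolutelyIrreducible ρ) ∧ κ₁.IsCyclotomic ∧ κ₂.IsAnticyclotomic ∧ (∃ ζ : ℤ_[p]ˣ, IsOfFinOrder ζ ∧ ((Literature.NumberTheory.GaloisRepresentations.GaloisRep.cyclotomicCharacter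 K p γ₁ * ζ : ℤ_[p]ˣ) : ℤ_[p]) = (Literature.NumberTheory.EllipticCurves.cyclotomicGenerator p : ℤ_[p])) ∧ ∀ (Ω δ : ℂ) (Ωp : (Literature.NumberTheory.EllipticCurves.unrIntegers p)ˣ) (LK G G' : PowerSeries (PowerSeries (PadicComplexInt p))), Ω ≠ 0 → (δ ^ 2 = (NumberField.discr K : ℂ) ∨ δ ^ 2 = -(NumberField.discr K : ℂ)) → Literature.NumberTheory.EllipticCurves.IsKatzMeasure₂ ι v vbar ∅ κ₁ κ₂ γ₁⁻¹ γ₂⁻¹ 1 Ω δ ((Ωp : Literature.NumberTheory.EllipticCurves.unrIntegers p) : PadicComplex p) LK → Literature.NumberTheory.EllipticCurves.IsGreenbergLFunctionAnyRoot₂ ι v vbar κ₁ κ₂ γ₁⁻¹ γ₂⁻¹ f (NumberField.discr K).natAbs (NumberField.classNumber K) LK G → Literature.NumberTheory.EllipticCurves.IsGreenbergLFunctionAnyRoot₂ ι v vbar κ₁ κ₂ γ₁⁻¹ γ₂⁻¹ f' (NumberField.discr K).natAbs (NumberField.classNumber K) LK G' → ∀ J : ℤ_[p] →+* PadicComplexInt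 p, (∀ x : ℤ_[p], ((J x : PadicComplexInt p) : PadicComplex p) = ((x : ℚ_[p]) : PadicComplex p)) → ∃ s : PowerSeries (PadicComplexInt p), s ≠ 0 ∧ Ideal.span {PowerSeries.map (PowerSeries.C (R := PadicComplexInt p)) s} * ((WeierstrassCurve.XGr₂.charIdeal (W.baseChange K) p κ₁ κ₂ vbar γ₁ γ₂).map (Literature.NumberTheory.EllipticCurves.IwasawaAlgebra₂.toUnr₂ p J) * (WeierstrassCurve.XGr₂.charIdeal (W'.baseChange K) p κ₁ κ₂ vbar γ₁ γ₂).map (Literature.NumberTheory.EllipticCurves.IwasawaAlgebra₂.toUnr₂ p J)) ≤ Ideal.span {G * G'}))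
    (hμan₀ : ∀ (W : WeierstrassCurve ℚ) [W.IsElliptic] [W.IsGloballyMinimal] (p : ℕ) [Fact p.Prime],
      p ≠ 2 → ClassX7 W p → ¬ W.HasCM → W.frobeniusTrace p = 0 → ¬ Surj W p →
      ∀ [NeZero (W.conductorNorm ℤ)] (f : CuspForm (Gamma0 (W.conductorNorm ℤ)) 2),
      IsNewformOf W f → ∃ (ε₀ : ℤˣ) (L₀ : IwasawaAlgebra p),
        IsSignedPAdicLFunction f p ε₀ L₀ ∧ HasUnitContent L₀)
    (hthree : ∀ (W : WeierstrassCurve ℚ) [W.IsElliptic] [W.IsGloballyMinimal] (p : ℕ) [Fact p.Prime],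
      p = 3 → ClassX7 W p → ¬ W.HasCM → W.frobeniusTrace p = 0 → ¬ Surj W p →
      ∃ ε : ℤˣ, Summit.BirchSwinnertonDyer.Rank1Residual.Supersingular.KobayashiLowerDivisibility W p ε) :
    Summit.BirchSwinnertonDyer.BirchSwinnertonDyer.Theses.SignedLowerHalves.KobayashiMainConjectureSmallImage := by
  intro W _ _ p hp hp2 hX hcm hap hs
  -- saturation for EVERY sign from the one-sign rider (k3-c4x lane B, part 4)
  have hsat := SmallImageSignedMuTransfer.stub_saturationSmallImage_of_signedMuAn_oneSign hCK h12 h41 h5 h3 hμan₀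
    W p hp2 hX hcm hap hs
  suffices hlow : ∃ ε : ℤˣ, Summit.BirchSwinnertonDyer.Rank1Residual.Supersingular.KobayashiLowerDivisibility W p ε by
    obtain ⟨ε, hε⟩ := hlow
    exact ⟨ε, hsat ε hε⟩
  by_cases hp5 : 5 ≤ p
  · haveI : NeZero (W.conductorNorm ℤ) := ⟨(W.conductorNorm_pos_holds).ne'⟩
    obtain ⟨Dm⟩ := hmodP W
    obtain ⟨ε₀, L₀, hL₀, hu⟩ := hμan₀ W p hp2 hX hcm hap hs Dm.f Dm.isNewformOf
    have hP := hT3 ⟨h422, hpkg⟩ hmodP W p hp5 hX hcm hap hs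
    refine ⟨ε₀, kobayashiLowerDivisibility_of_package_of_signed_hasUnitContent_noSurj h422 hpkg h41 h12 hmodP h5
      hGF W p hp5 hX hP ε₀ ?_⟩
    intro _ f hf
    have hfeq : f = Dm.f := hf.unique Dm.isNewformOf
    subst hfeq
    exact ⟨L₀, hL₀, hu⟩
  · have h2 := hp.out.two_le
    have hp3 : p = 3 := by
      interval_cases p
      · exact absurd rfl hp2
      · rfl
      · exact absurd hp.out (by decide)
    exact hthree W p hp3 hX hcm hap hs

end Summit.BirchSwinnertonDyer.BirchSwinnertonDyer.Theorems.SmallImageAcnsCrux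

end
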